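import Literature.Probability.LatticeModels.GKSInequalities
import Literature.Probability.LatticeModels.CouplingPathCalculus
import HarnessLib

/-!
# One-site decoupling in ferromagnetic generalised Ising systems and the iterated ("mean-field") bound
# on correlations — the Griffiths-inequality mechanism of Tomboulis–Ukawa–Windey / Sá Barreto–O'Carroll

Topic `Probability/LatticeModels`, namespace `Literature.Probability.LatticeModels`. Sequel of
`GKSInequalities` (the generalised Ising system `ν_{s;K} ∝ exp(∑_{i∈s} Kᵢ ω_{Cᵢ})` of Friedli–Velenik
§3.8.1: `gksExpect`, GKS I `gksExpect_spinProduct_nonneg`, GKS II / comparison of couplings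
`gksExpect_mono_of_abs_le`) and of `CouplingPathCalculus` (the coupling path `cplAt K B t`, which
multiplies the couplings of the terms `i ∈ B` by `t`, and the derivative formula
`hasDerivAt_gksExpect_cplAt_cov_spinProduct`, Glimm–Jaffe Prop. 4.2.1).

## The printed argument

A. L. Mota, F. C. Sá Barreto, *Correlations equalities and some upper bounds for the coupling
constant implying area decay of Wilson loop for `Z₃` lattice gauge theories*, arXiv:2402.12277 =
Physica Scripta (2024) [MotaSaBarreto2024], **§2 "Mean field lower bounds"** (restating, for `Z_N`
lattice gauge theories with Wilson action and free boundary conditions, the Griffiths-inequality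
("decoupling") argument of F. C. Sá Barreto, M. O'Carroll, J. Phys. A 16 (1983) L431
[SaBarretoOCarroll1983Z2] and of E. Tomboulis, A. Ukawa, P. Windey, Nucl. Phys. B 180 (1981) 294
[TomboulisUkawaWindey1981], both cited there and neither held by this project): fix a bond `b` of
the loop `C`, replace `β` by `λβ` on the `2(d-1)` plaquettes `P₁, …, P_{2(d-1)}` containing `b`;
then `⟨W(C)⟩₀ = 0` and, by Griffiths' first and second inequalities,

  `⟨W(C)⟩ = ∫₀¹ dλ (d/dλ)⟨W(C)⟩_λ = β ∫₀¹ dλ ∑ᵢ (⟨W(C) χ_{Pᵢ}⟩_λ - ⟨W(C)⟩_λ ⟨χ_{Pᵢ}⟩_λ)`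
  `       ≤ β ∫₀¹ dλ ∑ᵢ ⟨W(C) χ_{Pᵢ}⟩_λ ≤ β ∑ᵢ ⟨W(C) χ_{Pᵢ}⟩`                         (eq. (3)),

"each term on the right corresponds to a modified contour … we repeat the argument … after `A`
applications we arrive at `⟨W(C)⟩ ≤ β^A (sum of [2(d-1)]^A terms)`", each `≤ 1`, so
`⟨W(C)⟩ ≤ [2(d-1)β]^A` (eqs. (4)–(5)): area decay for `β < 1/(2(d-1))`.

## What is proved here (the abstract mechanism, for ANY ferromagnetic generalised Ising system)

* §1 `gksSum_spinProduct_eq_zero_of_mem`, `gksExpect_spinProduct_eq_zero_of_mem`: if a site `b ∈ A`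
  carries no interaction (every term containing `b` has coupling `0`), then `⟨σ_A⟩ = 0` (flip the spin
  at `b`).
* §2 **the one-site decoupling inequality** `gksExpect_spinProduct_le_sum_decouple`: for `K ≥ 0` and
  `b ∈ A`,
  `⟨σ_A⟩_K ≤ ∑_{i ∈ s, b ∈ Cᵢ} Kᵢ ⟨σ_{A ∆ Cᵢ}⟩_K`
  (eq. (3) of the source, with `W(C) χ_P = σ_{C ∆ ∂P}` for `±1` spins; the derivative along
  `cplAt K B t`, `B = {i ∈ s : b ∈ Cᵢ}`, is bounded on `[0,1]` using GKS I for the subtracted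
  product and the comparison of couplings `|t Kᵢ| ≤ Kᵢ` for the remaining term, and the value at
  `t = 0` vanishes by §1; mean value inequality).
* §3 `oddSpan T C` — the sites lying in an odd number of the sets `Cᵢ`, `i ∈ T` (the mod-2 sum
  `∆_{i∈T} Cᵢ`), with `oddSpan_insert`, `oddSpan_erase`, `spinProduct_oddSpan`
  (`σ_{oddSpan T C} = ∏_{i∈T} σ_{Cᵢ}`).
* §4 **the iterated bound** `gksExpect_spinProduct_le_pow`: if `0 ≤ Kᵢ ≤ κ`, every site lies in
  at most `m` interaction sets, and every `T ⊆ s` with `oddSpan T C = A` has at least `n`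
  elements, then `⟨σ_A⟩_K ≤ (m κ)^n` (eqs. (4)–(5); the printed "after `A` applications" is made
  precise as an induction on `k` for the bound `(mκ)^{min k n}`, the spanning number of `A ∆ Cᵢ`
  being at least that of `A` minus one).

The lattice-gauge-theory application (`ℤ₂` Wilson loops on the torus, `m = 2(d-1)`, `n = RT` for
an `R × T` rectangle, hence `⟨W_{R×T}⟩ ≤ (2(d-1)β)^{RT}` and the area law for `β < 1/(2(d-1))`) is
the sequel `Literature/MathematicalPhysics/QuantumFieldTheory/Z2AreaLawGKS.lean`; the geometric
input there (a set of plaquettes spanning the rectangle mod 2 has at least `RT` elements) is what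
the printed "proceeding along successive rows of plaquettes enclosed by `C`" takes for granted.
Nothing in this file is specific to gauge theories: for the nearest-neighbour Ising model
(`Cᵢ` = edges, `m = 2d`, `n` = graph distance) §4 is the classical mean-field decay bound
`⟨σ_x σ_y⟩ ≤ (2dβ)^{|x-y|}`.

## References

* A. L. Mota, F. C. Sá Barreto, arXiv:2402.12277 (2024), §2, eqs. (3)–(5). [MotaSaBarreto2024]
* F. C. Sá Barreto, M. O'Carroll, J. Phys. A 16 (1983) L431–L434. [SaBarretoOCarroll1983Z2]
* E. Tomboulis, A. Ukawa, P. Windey, Nucl. Phys. B 180 (1981) 294–300. [TomboulisUkawaWindey1981]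
* S. Friedli, Y. Velenik, *Statistical Mechanics of Lattice Systems* (2017), §3.8.1, Thm. 3.49,
  Exercise 3.31. [FriedliVelenik2017]
* J. Glimm, A. Jaffe, *Quantum Physics* (1987), §4.2, Prop. 4.2.1. [GlimmJaffe1987]
-/

noncomputable section

open Finset Set
open scoped symmDiff

namespace Literature.Probability.LatticeModels

variable {Λ : Type*} [Fintype Λ] [DecidableEq Λ] {ι : Type*} [DecidableEq ι]
variable (s : Finset ι) (K : ι → ℝ) (C : ι → Finset Λ)

/-! ## §1 A site without interaction: odd observables vanish -/

omit [DecidableEq ι] in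
/-- **Flip symmetry at one site.** If `b ∈ A` and every interaction term containing `b` has
coupling zero, then `Z⟨σ_A⟩ = 0`: the weight is invariant and `σ_A` is odd under the flip of the
spin at `b` (Friedli–Velenik 2017, §3.7.1, the spin-flip argument, at a single site).
[cite: FriedliVelenik2017, §3.7.1, eq. (3.33)] -/
theorem gksSum_spinProduct_eq_zero_of_mem (K' : ι → ℝ) {A : Finset Λ} {b : Λ} (hb : b ∈ A)
    (h : ∀ i ∈ s, K' i = 0 ∨ b ∉ C i) : gksSum s K' C (spinProduct A) = 0 := by
  have hw : ∀ σ, gksWeight s K' C (flipOn {b} σ) = gksWeight s K' C σ := by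
    intro σ
    simp only [gksWeight, gksHamiltonian]
    congr 1
    refine Finset.sum_congr rfl fun i hi => ?_
    rw [spinProduct_flipOn]
    rcases h i hi with h0 | hbi
    · simp [h0]
    · rw [Finset.inter_singleton_of_notMem hbi, Finset.card_empty, pow_zero, one_mul]
  have hodd : ∀ σ, spinProduct A (flipOn {b} σ) = -spinProduct A σ := by
    intro σ
    rw [spinProduct_flipOn, Finset.inter_singleton_of_mem hb, Finset.card_singleton, pow_one,
      neg_one_mul]
  unfold gksSum
  have h1 : ∑ σ, spinProduct A σ * gksWeight s K' C σ =
      ∑ σ, spinProduct A (flipOn {b} σ) * gksWeight s K' C (flipOn {b} σ) :=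
    (Fintype.sum_bijective _ (flipOn_involutive {b}).bijective _ _ fun _ => rfl).symm
  have h2 : ∑ σ, spinProduct A (flipOn {b} σ) * gksWeight s K' C (flipOn {b} σ) =
      -∑ σ, spinProduct A σ * gksWeight s K' C σ := by
    rw [← Finset.sum_neg_distrib]
    exact Finset.sum_congr rfl fun σ _ => by rw [hodd, hw]; ring
  linarith

omit [DecidableEq ι] in
/-- Normalised form of the flip symmetry: `⟨σ_A⟩ = 0` when some `b ∈ A` carries no interaction.
[cite: FriedliVelenik2017, §3.7.1, eq. (3.33)] -/
theorem gksExpect_spinProduct_eq_zero_of_mem (K' : ι → ℝ) {A : Finset Λ} {b : Λ} (hb : b ∈ A)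
    (h : ∀ i ∈ s, K' i = 0 ∨ b ∉ C i) : gksExpect s K' C (spinProduct A) = 0 := by
  rw [gksExpect, gksSum_spinProduct_eq_zero_of_mem s C K' hb h, zero_div]

/-! ## §2 The one-site decoupling inequality -/

/-- **One-site decoupling inequality** (Tomboulis–Ukawa–Windey 1981; Sá Barreto–O'Carroll 1983;
as restated in Mota–Sá Barreto 2024, §2 eq. (3): `⟨W(C)⟩ ≤ β ∑ᵢ ⟨W(C) χ_{Pᵢ}⟩`, the sum over the
plaquettes containing a fixed bond of `C`). For a ferromagnetic generalised Ising system
(`Kᵢ ≥ 0`) and a site `b ∈ A`: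

  `⟨σ_A⟩_K ≤ ∑_{i ∈ s, b ∈ Cᵢ} Kᵢ ⟨σ_{A ∆ Cᵢ}⟩_K`.

Proof as printed: along the path multiplying the couplings of the terms containing `b` by `t`,
`⟨σ_A⟩₀ = 0` (§1) and `d/dt ⟨σ_A⟩_t = ∑ᵢ Kᵢ (⟨σ_A σ_{Cᵢ}⟩_t - ⟨σ_A⟩_t ⟨σ_{Cᵢ}⟩_t) ≤ ∑ᵢ Kᵢ ⟨σ_{A∆Cᵢ}⟩_t
≤ ∑ᵢ Kᵢ ⟨σ_{A∆Cᵢ}⟩_K` for `t ∈ [0,1]` by Griffiths' first and second inequalities.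
[cite: MotaSaBarreto2024, §2 eq. (3)] -/
theorem gksExpect_spinProduct_le_sum_decouple (hK : ∀ i ∈ s, 0 ≤ K i) {A : Finset Λ} {b : Λ}
    (hb : b ∈ A) :
    gksExpect s K C (spinProduct A) ≤
      ∑ i ∈ s.filter (fun i => b ∈ C i), K i * gksExpect s K C (spinProduct (A ∆ C i)) := by
  set B : Finset ι := s.filter (fun i => b ∈ C i) with hBdef
  have hBs : B ⊆ s := Finset.filter_subset _ _
  set M : ℝ := ∑ i ∈ B, K i * gksExpect s K C (spinProduct (A ∆ C i)) with hM
  set Φ : ℝ → ℝ := fun t => gksExpect s (cplAt K B t) C (spinProduct A) with hΦ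
  set Φ' : ℝ → ℝ := fun t => ∑ i ∈ B, K i *
      (gksExpect s (cplAt K B t) C (fun ω => spinProduct A ω * spinProduct (C i) ω) -
        gksExpect s (cplAt K B t) C (spinProduct A) *
          gksExpect s (cplAt K B t) C (spinProduct (C i))) with hΦ'
  have hder : ∀ t, HasDerivAt Φ (Φ' t) t := fun t =>
    hasDerivAt_gksExpect_cplAt_cov_spinProduct s K C B hBs (spinProduct A) t
  -- the derivative is bounded by `M` on `[0, 1]`
  have hbound : ∀ t, 0 ≤ t → t ≤ 1 → Φ' t ≤ M := by
    intro t ht0 ht1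
    refine Finset.sum_le_sum fun i hi => mul_le_mul_of_nonneg_left ?_ (hK i (hBs hi))
    have hKt : ∀ i ∈ s, 0 ≤ cplAt K B t i := cplAt_nonneg s K B hK ht0
    have h1 : 0 ≤ gksExpect s (cplAt K B t) C (spinProduct A) *
        gksExpect s (cplAt K B t) C (spinProduct (C i)) :=
      mul_nonneg (gksExpect_spinProduct_nonneg _ _ _ hKt _) (gksExpect_spinProduct_nonneg _ _ _ hKt _)
    have h2 : gksExpect s (cplAt K B t) C (fun ω => spinProduct A ω * spinProduct (C i) ω) =
        gksExpect s (cplAt K B t) C (spinProduct (A ∆ C i)) := by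
      congr 1
      funext ω
      exact spinProduct_mul_eq_spinProduct_symmDiff A (C i) ω
    have h3 : gksExpect s (cplAt K B t) C (spinProduct (A ∆ C i)) ≤
        gksExpect s K C (spinProduct (A ∆ C i)) :=
      gksExpect_mono_of_abs_le s C (abs_cplAt_le s K B hK ht0 ht1) _
    rw [h2]
    linarith
  -- mean value inequality on `[0, 1]`
  have hdiff : Differentiable ℝ Φ := fun t => (hder t).differentiableAt
  have hderiv_le : ∀ t ∈ interior (Set.Icc (0 : ℝ) 1), deriv Φ t ≤ M := by
    intro t ht
    rw [interior_Icc] at ht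
    rw [(hder t).deriv]
    exact hbound t ht.1.le ht.2.le
  have hmvt := (convex_Icc (0 : ℝ) 1).image_sub_le_mul_sub_of_deriv_le hdiff.continuous.continuousOn
    hdiff.differentiableOn hderiv_le 0 (Set.left_mem_Icc.2 zero_le_one) 1
    (Set.right_mem_Icc.2 zero_le_one) zero_le_one
  have h1 : Φ 1 = gksExpect s K C (spinProduct A) := by simp only [hΦ, cplAt_one]
  have h0 : Φ 0 = 0 := by
    simp only [hΦ, cplAt_zero]
    refine gksExpect_spinProduct_eq_zero_of_mem s C (cplOff K B) hb fun i hi => ?_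
    by_cases hbi : b ∈ C i
    · left
      have hiB : i ∈ B := by rw [hBdef, Finset.mem_filter]; exact ⟨hi, hbi⟩
      simp [cplOff, hiB]
    · exact Or.inr hbi
  rw [h1, h0] at hmvt
  norm_num at hmvt
  exact hmvt

/-- The one-site decoupling inequality for a **uniform** coupling `β ≥ 0` (the printed form,
`⟨W(C)⟩ ≤ β ∑_{P ∋ b} ⟨W(C) χ_P⟩`). [cite: MotaSaBarreto2024, §2 eq. (3)] -/
theorem gksExpect_spinProduct_le_mul_sum_decouple {β : ℝ} (hβ : 0 ≤ β) {A : Finset Λ} {b : Λ}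
    (hb : b ∈ A) :
    gksExpect s (fun _ => β) C (spinProduct A) ≤
      β * ∑ i ∈ s.filter (fun i => b ∈ C i), gksExpect s (fun _ => β) C (spinProduct (A ∆ C i)) := by
  rw [Finset.mul_sum]
  exact gksExpect_spinProduct_le_sum_decouple s (fun _ => β) C (fun _ _ => hβ) hb

/-! ## §3 The mod-2 span of a set of interaction terms -/

/-- **The mod-2 span** `∆_{i ∈ T} Cᵢ` of the interaction sets indexed by `T`: the sites lying in an
odd number of them (for `±1` spins, `∏_{i∈T} σ_{Cᵢ} = σ_{oddSpan T C}`; in lattice gauge theory,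
the mod-2 boundary of the set of plaquettes `T`). [folklore] -/
def oddSpan (T : Finset ι) (C : ι → Finset Λ) : Finset Λ :=
  Finset.univ.filter fun b => Odd #(T.filter fun i => b ∈ C i)

omit [DecidableEq ι] in
/-- Membership in the mod-2 span (bookkeeping for the "modified contours" of the cited argument).
[cite: MotaSaBarreto2024, §2 (text after eq. (3))] -/
theorem mem_oddSpan_iff {T : Finset ι} {b : Λ} :
    b ∈ oddSpan T C ↔ Odd #(T.filter fun i => b ∈ C i) := by
  simp [oddSpan]

omit [DecidableEq ι] in
/-- The empty family spans the empty set (bookkeeping for the cited argument).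
[cite: MotaSaBarreto2024, §2 (text after eq. (3))] -/
@[simp] theorem oddSpan_empty : oddSpan (∅ : Finset ι) C = ∅ := by
  ext b
  simp [oddSpan]

/-- Adding a term `i ∉ T` changes the span by `∆ Cᵢ` ("each term … corresponds to a modified
contour … which enlarges or diminishes `C` by one plaquette").
[cite: MotaSaBarreto2024, §2 (text after eq. (3))] -/
theorem oddSpan_insert {T : Finset ι} {i : ι} (hi : i ∉ T) :
    oddSpan (insert i T) C = oddSpan T C ∆ C i := by
  ext b
  rw [Finset.mem_symmDiff, mem_oddSpan_iff, mem_oddSpan_iff, Finset.filter_insert]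
  by_cases hb : b ∈ C i
  · rw [if_pos hb, Finset.card_insert_of_notMem (fun h => hi (Finset.mem_filter.1 h).1),
      Nat.odd_add_one]
    constructor
    · intro h
      exact Or.inr ⟨hb, h⟩
    · rintro (⟨-, h'⟩ | ⟨-, h'⟩)
      · exact absurd hb h'
      · exact h'
  · rw [if_neg hb]
    constructor
    · intro h
      exact Or.inl ⟨h, hb⟩
    · rintro (⟨h, -⟩ | ⟨h, -⟩)
      · exact h
      · exact absurd h hb

/-- Removing a term `i ∈ T` changes the span by `∆ Cᵢ` (same bookkeeping).
[cite: MotaSaBarreto2024, §2 (text after eq. (3))] -/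
theorem oddSpan_erase {T : Finset ι} {i : ι} (hi : i ∈ T) :
    oddSpan (T.erase i) C = oddSpan T C ∆ C i := by
  have h := oddSpan_insert C (T := T.erase i) (i := i) (Finset.notMem_erase i T)
  rw [Finset.insert_erase hi] at h
  rw [h, symmDiff_assoc, symmDiff_self, symmDiff_bot]

/-- **`∏_{i ∈ T} σ_{Cᵢ} = σ_{oddSpan T C}`** (`σ_x² = 1`; Friedli–Velenik's `ω_A ω_B = ω_{A∆B}`,
§3.8.1, iterated: the modified contour of `W(C) χ_{P₁} ⋯ χ_{P_k}`).
[cite: FriedliVelenik2017, §3.8.1 (proof of Thm. 3.49)] -/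
theorem spinProduct_oddSpan (T : Finset ι) (ω : SpinConfig Λ) :
    spinProduct (oddSpan T C) ω = ∏ i ∈ T, spinProduct (C i) ω := by
  induction T using Finset.induction_on with
  | empty => simp
  | insert i T hi ih =>
    rw [oddSpan_insert C hi, Finset.prod_insert hi, ← spinProduct_mul_eq_spinProduct_symmDiff, ih,
      mul_comm]

/-! ## §4 The iterated ("mean-field") bound -/

omit [DecidableEq ι] in
/-- `⟨σ_A⟩_K ≤ 1` ("each term is non-negative and bounded above by 1").
[cite: MotaSaBarreto2024, §2 (text before eq. (5))] -/
theorem gksExpect_spinProduct_le_one (A : Finset Λ) : gksExpect s K C (spinProduct A) ≤ 1 :=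
  (le_abs_self _).trans (abs_gksExpect_le s K C fun ω => abs_spinProduct_le_one A ω)

omit [DecidableEq ι] in
/-- If every `T ⊆ s` spanning `A` (mod 2) has at least `n ≥ 1` elements, then `A` is nonempty.
[folklore] -/
private theorem nonempty_of_forall_oddSpan_le {A : Finset Λ} {n : ℕ} (hn : 1 ≤ n)
    (hA : ∀ T ⊆ s, oddSpan T C = A → n ≤ #T) : A.Nonempty := by
  rw [Finset.nonempty_iff_ne_empty]
  rintro rfl
  have h := hA ∅ (Finset.empty_subset _) (oddSpan_empty C)
  rw [Finset.card_empty] at h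
  omega

/-- The spanning number drops by at most one under `A ↦ A ∆ Cᵢ` (`i ∈ s`): if every `T ⊆ s`
spanning `A` has `≥ n` elements, every `T ⊆ s` spanning `A ∆ Cᵢ` has `≥ n - 1`. [folklore] -/
private theorem forall_oddSpan_symmDiff_le {A : Finset Λ} {n : ℕ} (hA : ∀ T ⊆ s, oddSpan T C = A → n ≤ #T)
    {i : ι} (his : i ∈ s) : ∀ T ⊆ s, oddSpan T C = A ∆ C i → n - 1 ≤ #T := by
  intro T hTs hT
  by_cases hiT : i ∈ T
  · have h1 : oddSpan (T.erase i) C = A := by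
      rw [oddSpan_erase C hiT, hT, symmDiff_assoc, symmDiff_self, symmDiff_bot]
    have h2 := hA (T.erase i) ((Finset.erase_subset _ _).trans hTs) h1
    have h3 := Finset.card_erase_of_mem hiT
    omega
  · have h1 : oddSpan (insert i T) C = A := by
      rw [oddSpan_insert C hiT, hT, symmDiff_assoc, symmDiff_self, symmDiff_bot]
    have h2 := hA (insert i T) (Finset.insert_subset his hTs) h1
    rw [Finset.card_insert_of_notMem hiT] at h2
    omega

/-- **The iterated bound, inductive form.** For `0 ≤ Kᵢ ≤ κ`, at most `m` interaction sets
through every site, and every `k`: if every `T ⊆ s` with `oddSpan T C = A` has at least `n`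
elements, then `⟨σ_A⟩_K ≤ (mκ)^{min k n}` (Mota–Sá Barreto 2024, §2, the passage from eq. (3) to
eqs. (4)–(5): "we repeat the argument … after `A` applications"). [cite: MotaSaBarreto2024, §2 eqs. (4)–(5)] -/
theorem gksExpect_spinProduct_le_pow_min (hK : ∀ i ∈ s, 0 ≤ K i) {κ : ℝ} (hκ0 : 0 ≤ κ)
    (hκ : ∀ i ∈ s, K i ≤ κ) {m : ℕ} (hm : ∀ b : Λ, #(s.filter fun i => b ∈ C i) ≤ m) :
    ∀ (k : ℕ) (A : Finset Λ) (n : ℕ), (∀ T ⊆ s, oddSpan T C = A → n ≤ #T) →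
      gksExpect s K C (spinProduct A) ≤ ((m : ℝ) * κ) ^ (min k n) := by
  intro k
  induction k with
  | zero =>
    intro A n _
    rw [Nat.zero_min, pow_zero]
    exact gksExpect_spinProduct_le_one s K C A
  | succ k ih =>
    intro A n hn
    rcases Nat.eq_zero_or_pos n with rfl | hnpos
    · rw [Nat.min_zero, pow_zero]
      exact gksExpect_spinProduct_le_one s K C A
    obtain ⟨b, hb⟩ := nonempty_of_forall_oddSpan_le s C hnpos hn
    have hmk : 0 ≤ ((m : ℝ) * κ) ^ (min k (n - 1)) := pow_nonneg (mul_nonneg (Nat.cast_nonneg m) hκ0) _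
    have hterm : ∀ i ∈ s.filter (fun i => b ∈ C i),
        K i * gksExpect s K C (spinProduct (A ∆ C i)) ≤ κ * ((m : ℝ) * κ) ^ (min k (n - 1)) := by
      intro i hi
      have his : i ∈ s := (Finset.mem_filter.1 hi).1
      have hIH := ih (A ∆ C i) (n - 1) (forall_oddSpan_symmDiff_le s C hn his)
      exact mul_le_mul (hκ i his) hIH (gksExpect_spinProduct_nonneg s K C hK _) hκ0
    calc gksExpect s K C (spinProduct A)
        ≤ ∑ i ∈ s.filter (fun i => b ∈ C i), K i * gksExpect s K C (spinProduct (A ∆ C i)) :=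
          gksExpect_spinProduct_le_sum_decouple s K C hK hb
      _ ≤ ∑ _i ∈ s.filter (fun i => b ∈ C i), κ * ((m : ℝ) * κ) ^ (min k (n - 1)) :=
          Finset.sum_le_sum hterm
      _ = #(s.filter fun i => b ∈ C i) * (κ * ((m : ℝ) * κ) ^ (min k (n - 1))) := by
          rw [Finset.sum_const, nsmul_eq_mul]
      _ ≤ m * (κ * ((m : ℝ) * κ) ^ (min k (n - 1))) := by
          refine mul_le_mul_of_nonneg_right ?_ (mul_nonneg hκ0 hmk)
          exact_mod_cast hm b
      _ = ((m : ℝ) * κ) ^ (min k (n - 1) + 1) := by ring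
      _ = ((m : ℝ) * κ) ^ (min (k + 1) n) := by
          congr 1
          omega

/-- **The iterated ("mean-field") bound on correlations of a ferromagnetic generalised Ising
system** (Tomboulis–Ukawa–Windey 1981; Sá Barreto–O'Carroll 1983; Mota–Sá Barreto 2024, §2
eqs. (4)–(5)). If `0 ≤ Kᵢ ≤ κ` on `s`, every site lies in at most `m` of the interaction sets
`Cᵢ` (`i ∈ s`), and every family `T ⊆ s` of terms with `∆_{i∈T} Cᵢ = A` has at least `n` members,
then

  `0 ≤ ⟨σ_A⟩_K ≤ (m κ)^n`.

(For the `ℤ₂` lattice gauge theory in `d` dimensions: `m = 2(d-1)`, `κ = β`, `A` = a Wilson loop,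
`n` = its minimal spanning area; for the nearest-neighbour Ising model: `m = 2d`, `A = {x, y}`,
`n = |x - y|₁`.) [cite: MotaSaBarreto2024, §2 eqs. (4)–(5)] -/
theorem gksExpect_spinProduct_le_pow (hK : ∀ i ∈ s, 0 ≤ K i) {κ : ℝ} (hκ0 : 0 ≤ κ)
    (hκ : ∀ i ∈ s, K i ≤ κ) {m : ℕ} (hm : ∀ b : Λ, #(s.filter fun i => b ∈ C i) ≤ m)
    {A : Finset Λ} {n : ℕ} (hn : ∀ T ⊆ s, oddSpan T C = A → n ≤ #T) :
    gksExpect s K C (spinProduct A) ≤ ((m : ℝ) * κ) ^ n := by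
  have h := gksExpect_spinProduct_le_pow_min s K C hK hκ0 hκ hm n A n hn
  rwa [min_self] at h

/-- Uniform-coupling form of the iterated bound: `⟨σ_A⟩_β ≤ (m β)^n` for `β ≥ 0`.
[cite: MotaSaBarreto2024, §2 eqs. (4)–(5)] -/
theorem gksExpect_const_spinProduct_le_pow {β : ℝ} (hβ : 0 ≤ β) {m : ℕ}
    (hm : ∀ b : Λ, #(s.filter fun i => b ∈ C i) ≤ m) {A : Finset Λ} {n : ℕ}
    (hn : ∀ T ⊆ s, oddSpan T C = A → n ≤ #T) :
    gksExpect s (fun _ => β) C (spinProduct A) ≤ ((m : ℝ) * β) ^ n :=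
  gksExpect_spinProduct_le_pow s (fun _ => β) C (fun _ _ => hβ) hβ (fun _ _ => le_rfl) hm hn

end Literature.Probability.LatticeModels
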